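import Summits.Ventures.PercRepro.ThetaOmegaCore
import Summits.Ventures.PercRepro.ThetaOmegaSmall
import Summits.Ventures.PercRepro.ThetaOmegaThird

/-!
# Credit mechanisms at an edge, the types of a bad one-edge point, and the V and Λ exclusions

Dossier proofs/MINE1-theoremS.md, Addendum 81 (mine-1, gen 42). Let `(s, s + q)` be an edge of
`F` in direction `q`. A `q`-edge of the `A`-family is produced by two members `x, y` whenever a
`q`-free element built from `s` and `y` and a `q`-element built from `s + q` and `x` coincide up
to `q` — the **pair mechanisms** (`qEdge_of_inf_inf`, `qEdge_of_inf_sdiff`, `qEdge_of_sdiff_inf`,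
`qEdge_of_sdiff_sdiff`, the co-join mechanism `qEdge_of_cojoin` in `C`, the cross-difference
mechanism `qEdge_of_cross`); the third-member edges of `ThetaOmegaThird.lean` are their diagonal
cases `x = y`. Two members whose difference is `{q}` give the edge `(∅, {q})` as soon as `∅ ∈ A`
(`empty_mem_qEdges_of_sdiff_eq_singleton`).

A **bad one-edge point** (`qEdges q F = {s}`, exceptional: `c0 (s + q) ≠ c1 s`, credit `0`) is of
one of three types once a third member exists (`one_edge_type`): **T10** (`s` anti `(λ, ¬λ)`,
`s + q` mono `λ`), **T01** (`s` mono `λ`, `s + q` anti `(¬λ, λ)`) or **T00** (`s` mono `γ`,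
`s + q` mono `¬γ`); the fourth colouring (both ends anti with the same colours) is never bad
(`one_le_credit_of_anti_same`). Two bad one-edge points never share their lower end
(`not_badV`) nor their upper end (`not_badLambda`): in every colour case one of the two edges gets
the edge `(∅, {q})` from the other's endpoint, or `colours_of_credit_eq_zero` is violated.
-/

namespace PercRepro.MSTight

open Finset

variable {α : Type*} [DecidableEq α]

section Mechanisms

variable {q : α} {U : Finset α} {F : Finset (Finset α)} {c0 c1 : Finset α → Bool} {s x y : Finset α}

/-- A `q`-edge of the `A`-family gives credit. -/
theorem one_le_omegaCredit_of_mem_qEdges_omegaA {d : Finset α}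
    (hd : d ∈ qEdges q (omegaA F c0 c1)) : 1 ≤ omegaCredit U F c0 c1 q := by
  unfold omegaCredit
  have := card_pos.2 ⟨d, hd⟩
  omega

/-- A `q`-edge of the `C`-family gives credit. -/
theorem one_le_omegaCredit_of_mem_qEdges_omegaC {d : Finset α}
    (hd : d ∈ qEdges q (omegaC U F c1)) : 1 ≤ omegaCredit U F c0 c1 q := by
  unfold omegaCredit
  have := card_pos.2 ⟨d, hd⟩
  omega

/-- **Meet–meet mechanism**: `y ≠ s` with `c0 y = c0 s`, `x ∋ q` with `x ≠ s + q`,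
`c0 x = c0 (s + q)`, and `s ⊓ y = s ⊓ x` give the `q`-edge `(s ⊓ y, (s + q) ⊓ x)` of `A`. -/
theorem qEdge_of_inf_inf (hs : s ∈ F) (hqs : q ∉ s) (hsq : insert q s ∈ F)
    (hy : y ∈ F) (hys : y ≠ s) (h0y : c0 y = c0 s)
    (hx : x ∈ F) (hxu : x ≠ insert q s) (h0x : c0 x = c0 (insert q s)) (hqx : q ∈ x)
    (heq : s ⊓ y = s ⊓ x) : s ⊓ y ∈ qEdges q (omegaA F c0 c1) := by
  rw [mem_qEdges]
  refine ⟨inf_mem_omegaA (Ne.symm hys) hs hy h0y.symm, ?_, ?_⟩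
  · simp only [inf_eq_inter, mem_inter, not_and]
    exact fun h => absurd h hqs
  · rw [heq, insert_inf_of_mem hqx]
    exact inf_mem_omegaA (Ne.symm hxu) hsq hx h0x.symm

/-- **Meet–difference mechanism**: `y ≠ s` with `c0 y = c0 s`, `x ∌ q` with `c0 (s + q) = c1 x`,
and `s ⊓ y = s \ x` give the `q`-edge `(s ⊓ y, (s + q) \ x)` of `A`. -/
theorem qEdge_of_inf_sdiff (hs : s ∈ F) (hqs : q ∉ s) (hsq : insert q s ∈ F)
    (hy : y ∈ F) (hys : y ≠ s) (h0y : c0 y = c0 s)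
    (hx : x ∈ F) (h0x : c0 (insert q s) = c1 x) (hqx : q ∉ x)
    (heq : s ⊓ y = s \ x) : s ⊓ y ∈ qEdges q (omegaA F c0 c1) := by
  rw [mem_qEdges]
  refine ⟨inf_mem_omegaA (Ne.symm hys) hs hy h0y.symm, ?_, ?_⟩
  · simp only [inf_eq_inter, mem_inter, not_and]
    exact fun h => absurd h hqs
  · rw [heq, ← insert_sdiff_of_notMem' hqx]
    exact sdiff_mem_omegaA hsq hx h0x

/-- **Difference–meet mechanism**: `y` with `c0 s = c1 y`, `x ∋ q` with `x ≠ s + q`,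
`c0 x = c0 (s + q)`, and `s \ y = s ⊓ x` give the `q`-edge `(s \ y, (s + q) ⊓ x)` of `A`. -/
theorem qEdge_of_sdiff_inf (hs : s ∈ F) (hqs : q ∉ s) (hsq : insert q s ∈ F)
    (hy : y ∈ F) (h0y : c0 s = c1 y)
    (hx : x ∈ F) (hxu : x ≠ insert q s) (h0x : c0 x = c0 (insert q s)) (hqx : q ∈ x)
    (heq : s \ y = s ⊓ x) : s \ y ∈ qEdges q (omegaA F c0 c1) := by
  rw [mem_qEdges]
  refine ⟨sdiff_mem_omegaA hs hy h0y, ?_, ?_⟩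
  · simp only [mem_sdiff, not_and]
    exact fun h => absurd h hqs
  · rw [heq, insert_inf_of_mem hqx]
    exact inf_mem_omegaA (Ne.symm hxu) hsq hx h0x.symm

/-- **Difference–difference mechanism**: `y` with `c0 s = c1 y`, `x ∌ q` with
`c0 (s + q) = c1 x`, and `s \ y = s \ x` give the `q`-edge `(s \ y, (s + q) \ x)` of `A`. -/
theorem qEdge_of_sdiff_sdiff (hs : s ∈ F) (hqs : q ∉ s) (hsq : insert q s ∈ F)
    (hy : y ∈ F) (h0y : c0 s = c1 y)
    (hx : x ∈ F) (h0x : c0 (insert q s) = c1 x) (hqx : q ∉ x)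
    (heq : s \ y = s \ x) : s \ y ∈ qEdges q (omegaA F c0 c1) := by
  rw [mem_qEdges]
  refine ⟨sdiff_mem_omegaA hs hy h0y, ?_, ?_⟩
  · simp only [mem_sdiff, not_and]
    exact fun h => absurd h hqs
  · rw [heq, ← insert_sdiff_of_notMem' hqx]
    exact sdiff_mem_omegaA hsq hx h0x

/-- **Co-join mechanism**: members `y ≠ s` with `c1 y = c1 s` and `x ≠ s + q` with `q ∉ x`,
`c1 x = c1 (s + q)`, and `s ⊔ y = s ⊔ x`, give the `q`-edge `(U \ ((s + q) ⊔ x), U \ (s ⊔ y))`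
of `C`. -/
theorem qEdge_of_cojoin (hq : q ∈ U) (hs : s ∈ F) (hqs : q ∉ s) (hsq : insert q s ∈ F)
    (hy : y ∈ F) (hys : y ≠ s) (h1y : c1 y = c1 s)
    (hx : x ∈ F) (hxu : x ≠ insert q s) (h1x : c1 x = c1 (insert q s)) (hqx : q ∉ x)
    (heq : s ⊔ y = s ⊔ x) : U \ (insert q s ⊔ x) ∈ qEdges q (omegaC U F c1) := by
  rw [mem_qEdges]
  refine ⟨sdiff_sup_mem_omegaC (Ne.symm hxu) hsq hx h1x.symm, ?_, ?_⟩
  · simp only [mem_sdiff, sup_eq_union, mem_union, mem_insert, true_or, not_true_eq_false,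
      and_false, not_false_eq_true]
  · rw [sdiff_insert_sup_eq, insert_sdiff_erase_sup hq hqs hqx, ← heq]
    exact sdiff_sup_mem_omegaC (Ne.symm hys) hs hy h1y.symm

/-- **Cross-difference mechanism**: `x ∋ q` with `c0 x = c1 s`, `y` with `c0 y = c1 (s + q)`, and
`x \ (s + q) = y \ (s + q)` give the `q`-edge `(y \ (s + q), x \ s)` of `A`. -/
theorem qEdge_of_cross (hs : s ∈ F) (hqs : q ∉ s) (hsq : insert q s ∈ F)
    (hx : x ∈ F) (hqx : q ∈ x) (h0x : c0 x = c1 s)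
    (hy : y ∈ F) (h0y : c0 y = c1 (insert q s))
    (heq : x \ insert q s = y \ insert q s) : y \ insert q s ∈ qEdges q (omegaA F c0 c1) := by
  rw [mem_qEdges]
  refine ⟨sdiff_mem_omegaA hy hsq h0y, ?_, ?_⟩
  · simp only [mem_sdiff, mem_insert, true_or, not_true_eq_false, and_false, not_false_eq_true]
  · rw [← heq, insert_sdiff_insert_of_mem hqx hqs]
    exact sdiff_mem_omegaA hx hs h0x

/-- **The singleton edge**: `∅ ∈ A` and `{q} ∈ A` give the `q`-edge `(∅, {q})`. -/
theorem empty_mem_qEdges_of_singleton_mem (h0 : ∅ ∈ omegaA F c0 c1)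
    (h1 : ({q} : Finset α) ∈ omegaA F c0 c1) : ∅ ∈ qEdges q (omegaA F c0 c1) := by
  rw [mem_qEdges]
  refine ⟨h0, notMem_empty q, ?_⟩
  rwa [insert_empty]

/-- Two members whose difference is `{q}` (with the colours of a difference) put `{q}` into `A`. -/
theorem singleton_mem_omegaA_of_sdiff (hx : x ∈ F) (hy : y ∈ F) (hc : c0 x = c1 y)
    (h : x \ y = {q}) : ({q} : Finset α) ∈ omegaA F c0 c1 :=
  h ▸ sdiff_mem_omegaA hx hy hc

/-- **Credit from a singleton difference**: a mono member (so that `∅ ∈ A`) and two members with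
`c0 x = c1 y`, `x \ y = {q}` give credit at `q`. -/
theorem one_le_omegaCredit_of_sdiff_eq_singleton {m : Finset α} (hm : m ∈ F) (hmono : c0 m = c1 m)
    (hx : x ∈ F) (hy : y ∈ F) (hc : c0 x = c1 y) (h : x \ y = {q}) :
    1 ≤ omegaCredit U F c0 c1 q :=
  one_le_omegaCredit_of_mem_qEdges_omegaA (empty_mem_qEdges_of_singleton_mem
    (empty_mem_omegaA_of_mono hm hmono) (singleton_mem_omegaA_of_sdiff hx hy hc h))

end Mechanisms

section Types

variable {q : α} {U : Finset α} {F : Finset (Finset α)} {c0 c1 : Finset α → Bool} {s : Finset α}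

/-- The Boolean case analysis behind `one_edge_type`. -/
theorem bool_one_edge_type (a b a' b' : Bool) (hexc : a' ≠ b) (hanti : ¬ (a = a' ∧ b = b' ∧ a ≠ b)) :
    (a = a' ∧ b' = a' ∧ b ≠ a') ∨ (b = b' ∧ a = b ∧ a' ≠ b) ∨ (a = b ∧ a' = b' ∧ a ≠ a') := by
  revert a b a' b'
  decide

/-- **The three types of a bad one-edge point**: at an exceptional edge `(s, s + q)`
(`c0 (s + q) ≠ c1 s`) with credit `0` and a third member, the colours are of type
T10 (`c0 s = c0 (s + q)`, `s + q` mono, `c1 s` the other colour), T01 (`c1 s = c1 (s + q)`, `s`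
mono, `c0 (s + q)` the other colour) or T00 (`s` mono, `s + q` mono, of different colours). -/
theorem one_edge_type (hq : q ∈ U) (hs : s ∈ F) (hqs : q ∉ s) (hsq : insert q s ∈ F)
    (hexc : c0 (insert q s) ≠ c1 s) (hcred : omegaCredit U F c0 c1 q = 0)
    {w : Finset α} (hw : w ∈ F) (hws : w ≠ s) (hwsq : w ≠ insert q s) :
    (c0 s = c0 (insert q s) ∧ c1 (insert q s) = c0 (insert q s) ∧ c1 s ≠ c0 (insert q s)) ∨
      (c1 s = c1 (insert q s) ∧ c0 s = c1 s ∧ c0 (insert q s) ≠ c1 s) ∨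
        (c0 s = c1 s ∧ c0 (insert q s) = c1 (insert q s) ∧ c0 s ≠ c0 (insert q s)) := by
  refine bool_one_edge_type (c0 s) (c1 s) (c0 (insert q s)) (c1 (insert q s)) hexc ?_
  rintro ⟨h0, h1, hanti⟩
  have := one_le_credit_of_anti_same (c0 := c0) (c1 := c1) hq hs hqs hsq h0.symm h1.symm hanti
    hw hws hwsq
  unfold omegaCredit at hcred
  omega

end Types

section VLambda

variable {q q' : α} {U : Finset α} {F : Finset (Finset α)} {c0 c1 : Finset α → Bool}

set_option synthInstance.maxSize 4096 in
/-- The Boolean case analysis of the V exclusion: `s = (a, b)`, `s + q = (a1, b1)`,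
`s + q' = (a2, b2)`. -/
theorem bool_not_badV (a b a1 b1 a2 b2 : Bool) (hexc : a1 ≠ b) (hexc' : a2 ≠ b)
    (h1 : (b = b1 → b2 ≠ b) ∧ (a = a1 → b2 ≠ a)) (h2 : (b = b2 → b1 ≠ b) ∧ (a = a2 → b1 ≠ a))
    (hsing : a = b → a1 = b2 → False) (hsing' : a = b → a2 = b1 → False) : False := by
  revert a b a1 b1 a2 b2
  decide

set_option synthInstance.maxSize 4096 in
/-- The Boolean case analysis of the Λ exclusion: `u = (a, b)`, `u \ q = (a1, b1)`,
`u \ q' = (a2, b2)`. -/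
theorem bool_not_badLambda (a b a1 b1 a2 b2 : Bool) (hexc : a ≠ b1) (hexc' : a ≠ b2)
    (h1 : (a1 = a → a2 ≠ a1) ∧ (b1 = b → a2 ≠ b1)) (h2 : (a2 = a → a1 ≠ a2) ∧ (b2 = b → a1 ≠ b2))
    (hsing : a2 = b2 → a2 = b1 → False) (hsing' : a1 = b1 → a1 = b2 → False) : False := by
  revert a b a1 b1 a2 b2
  decide

/-- The difference of the two upper ends of a V is the singleton of the first direction. -/
theorem insert_sdiff_insert_eq_singleton {s : Finset α} (hqq' : q ≠ q') (hqs : q ∉ s) :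
    insert q s \ insert q' s = {q} := by
  ext a
  simp only [mem_sdiff, mem_insert, mem_singleton, not_or]
  constructor
  · rintro ⟨rfl | ha, haq', has⟩
    · rfl
    · exact absurd ha has
  · rintro rfl
    exact ⟨Or.inl rfl, hqq', hqs⟩

/-- **No V of bad points**: two exceptional edges `(s, s + q)`, `(s, s + q')` with the same lower
end and both of credit `0` are impossible. -/
theorem not_badV (hq : q ∈ U) (hq' : q' ∈ U) (hqq' : q ≠ q') {s : Finset α} (hs : s ∈ F)
    (hqs : q ∉ s) (hq's : q' ∉ s) (hsq : insert q s ∈ F) (hsq' : insert q' s ∈ F)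
    (hexc : c0 (insert q s) ≠ c1 s) (hexc' : c0 (insert q' s) ≠ c1 s)
    (hcred : omegaCredit U F c0 c1 q = 0) (hcred' : omegaCredit U F c0 c1 q' = 0) : False := by
  have hne : insert q' s ≠ insert q s := by
    intro h
    have hmem : q ∈ insert q' s := h ▸ mem_insert_self q s
    rcases mem_insert.1 hmem with h' | h'
    · exact hqq' h'
    · exact hqs h'
  have hne' : insert q s ≠ insert q' s := Ne.symm hne
  have hw : insert q' s ≠ s := fun h => hq's (h ▸ mem_insert_self q' s)
  have hw' : insert q s ≠ s := fun h => hqs (h ▸ mem_insert_self q s)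
  -- the third-member constraints at `q` (with `w = s + q'`, `q ∉ w`) and at `q'`
  have hcol := colours_of_credit_eq_zero (c0 := c0) (c1 := c1) hq hs hqs hsq hcred hsq' hw hne
  have hcol' := colours_of_credit_eq_zero (c0 := c0) (c1 := c1) hq' hs hq's hsq' hcred' hsq hw' hne'
  have hqw : q ∉ insert q' s := by
    simp only [mem_insert, not_or]; exact ⟨hqq', hqs⟩
  have hq'w : q' ∉ insert q s := by
    simp only [mem_insert, not_or]; exact ⟨Ne.symm hqq', hq's⟩
  have h1 := (hcol.2 hqw)
  have h2 := (hcol'.2 hq'w)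
  clear hcol hcol'
  -- the singleton edges `(∅, {q})`, `(∅, {q'})` when `s` is mono
  have hsing : c0 s = c1 s → c0 (insert q s) = c1 (insert q' s) → False := by
    intro hmono hc
    have := one_le_omegaCredit_of_sdiff_eq_singleton (U := U) hs hmono hsq hsq' hc
      (insert_sdiff_insert_eq_singleton hqq' hqs)
    omega
  have hsing' : c0 s = c1 s → c0 (insert q' s) = c1 (insert q s) → False := by
    intro hmono hc
    have := one_le_omegaCredit_of_sdiff_eq_singleton (U := U) hs hmono hsq' hsq hc
      (insert_sdiff_insert_eq_singleton (Ne.symm hqq') hq's)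
    omega
  exact bool_not_badV _ _ _ _ _ _ hexc hexc' h1 h2 hsing hsing'

/-- The difference of the two lower ends of a Λ is the singleton of the first direction. -/
theorem erase_sdiff_erase_eq_singleton {u : Finset α} (hqq' : q ≠ q') (hqu : q ∈ u) :
    u.erase q' \ u.erase q = {q} := by
  ext a
  simp only [mem_sdiff, mem_erase, mem_singleton, not_and]
  constructor
  · rintro ⟨⟨haq', hau⟩, h⟩
    by_contra haq
    exact h haq hau
  · rintro rfl
    exact ⟨⟨hqq', hqu⟩, fun h _ => h rfl⟩

/-- **No Λ of bad points**: two exceptional edges `(u \ q, u)`, `(u \ q', u)` with the same upper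
end and both of credit `0` are impossible. -/
theorem not_badLambda (hq : q ∈ U) (hq' : q' ∈ U) (hqq' : q ≠ q') {u : Finset α} (hu : u ∈ F)
    (hqu : q ∈ u) (hq'u : q' ∈ u) (hs : u.erase q ∈ F) (hs' : u.erase q' ∈ F)
    (hexc : c0 u ≠ c1 (u.erase q)) (hexc' : c0 u ≠ c1 (u.erase q'))
    (hcred : omegaCredit U F c0 c1 q = 0) (hcred' : omegaCredit U F c0 c1 q' = 0) : False := by
  have hins : insert q (u.erase q) = u := insert_erase hqu
  have hins' : insert q' (u.erase q') = u := insert_erase hq'u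
  have hqs : q ∉ u.erase q := notMem_erase q u
  have hq's : q' ∉ u.erase q' := notMem_erase q' u
  have hne : u.erase q' ≠ u.erase q := by
    intro h
    have : q ∈ u.erase q' := mem_erase.2 ⟨hqq', hqu⟩
    rw [h] at this
    exact hqs this
  have hne' : u.erase q ≠ u.erase q' := Ne.symm hne
  have hwu : u.erase q' ≠ u := by
    intro h
    have := hq's
    rw [h] at this
    exact this hq'u
  have hwu' : u.erase q ≠ u := by
    intro h
    have := hqs
    rw [h] at this
    exact this hqu
  have hqw : q ∈ u.erase q' := mem_erase.2 ⟨hqq', hqu⟩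
  have hq'w : q' ∈ u.erase q := mem_erase.2 ⟨Ne.symm hqq', hq'u⟩
  have hsq : insert q (u.erase q) ∈ F := by rw [hins]; exact hu
  have hsq' : insert q' (u.erase q') ∈ F := by rw [hins']; exact hu
  have hwu1 : u.erase q' ≠ insert q (u.erase q) := by rw [hins]; exact hwu
  have hwu1' : u.erase q ≠ insert q' (u.erase q') := by rw [hins']; exact hwu'
  -- the third-member constraints at `q` (with `w = u \ q'`, `q ∈ w`) and at `q'`
  have hcol := colours_of_credit_eq_zero (c0 := c0) (c1 := c1) hq hs hqs hsq hcred hs' hne hwu1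
  have hcol' := colours_of_credit_eq_zero (c0 := c0) (c1 := c1) hq' hs' hq's hsq' hcred' hs hne'
    hwu1'
  rw [hins] at hcol
  rw [hins'] at hcol'
  have h1 := hcol.1 hqw
  have h2 := hcol'.1 hq'w
  clear hcol hcol'
  -- the singleton edges `(∅, {q})`, `(∅, {q'})` when one lower end is mono
  have hsing : c0 (u.erase q') = c1 (u.erase q') → c0 (u.erase q') = c1 (u.erase q) → False := by
    intro hmono hc
    have := one_le_omegaCredit_of_sdiff_eq_singleton (U := U) hs' hmono hs' hs hc
      (erase_sdiff_erase_eq_singleton hqq' hqu)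
    omega
  have hsing' : c0 (u.erase q) = c1 (u.erase q) → c0 (u.erase q) = c1 (u.erase q') → False := by
    intro hmono hc
    have := one_le_omegaCredit_of_sdiff_eq_singleton (U := U) hs hmono hs hs' hc
      (erase_sdiff_erase_eq_singleton (Ne.symm hqq') hq'u)
    omega
  exact bool_not_badLambda _ _ _ _ _ _ hexc hexc' h1 h2 hsing hsing'

end VLambda

end PercRepro.MSTight
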